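import Summits.Langlands.Langlands.Theses.QuadraticWindow
import Literature.NumberTheory.Automorphic.UnitaryCoherentGaloisRep
import Literature.NumberTheory.GaloisRepresentations.SatakeFamilyOfFramedGaloisRep
import Literature.NumberTheory.GaloisRepresentations.CompactImageCharpolyIntegral
import Literature.AlgebraicGeometry.Motives.ZarhinHodgeGroupAutC
import Literature.FieldTheory.AlgClosed.PadicAlgClEquivComplex
import Literature.NumberTheory.Automorphic.ReciprocityGLnQlModelProofs
import Literature.NumberTheory.GaloisRepresentations.FramedRepBaseChange

/-!
# Disproof of `GaloisRepOfUnitaryLDS` — standing adversary work file (crux `stmt-Langlands-15129`)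

Crux: `Summit.Langlands.Langlands.Theses.QuadraticWindow.GaloisRepOfUnitaryLDS` (route
`route-Langlands-QuadraticWindow`, rank 5), VERBATIM the named fact
`Literature.NumberTheory.Automorphic.GoldringKoskivirta2019_galoisRep_unitary` (Goldring–Koskivirta
2019, Thm. 3.5.5, LDS unitary case, for Mok's quasi-split `U_{K/F₀}(N)`).  cdisprove seat, cycle 1
(2026-08-16).  Everything below is `lean check` rc 0, no `sorry`; prose only in docstrings.

## Findings (index; `L` = proved below in Lean, `P` = on paper, in docstrings)

VERDICT: resists — and cannot be refuted in Lean as typed, for a structural reason: every instance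
of the hypotheses needs a genuine `UnitaryGroup.CuspidalAutomorphicRepData` (an irreducible
`(𝔲, K_∞) × U(𝔸_f)`-subquotient `W' < W ≤ cuspForms` of honest automorphic forms on
`U(J_N)(F₀)\U(J_N)(𝔸_{F₀})`) which is a non-degenerate limit of discrete series at every real place
(`IsNondegenerateLimitOfDiscreteSeriesAt`: infinitesimal character + minimal `K`-type through a
`Frame`, which forces `p + q = N`) and hyperspecial-unramified above `ℓ` (`HasBaseChangeSatakeAt`:
a level-`𝔫` spherical vector with the Cartier/Mínguez unramified Hecke eigenvalues).  The only
inhabitants within reach are `N = 0` (proved stratum, §1) and the trivial character of `U(1)`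
(calibration: its base-change parameter is forced to be `{1}` at every place by
`IsBaseChangeParam` / the order-one Hecke operator, and `r = 1` serves) — both CONSISTENT.

* §1 `L` anatomy: `crux ↔ fact` (`Iff.rfl`); `crux ↔ ∀ N, At N`; **`At 0` holds**; hence
  `crux ↔ ∀ N > 0, At N` — a disproof needs `N ≥ 1`.
* §2 `L` HIDDEN CONTENT OF THE CONCLUSION (the crux quantifies over EVERY `ι : ℚ̄_ℓ ≃+* ℂ` and EVERY
  base-change parameter `β` at a controlled place, so it silently contains three automorphic
  theorems, each a necessary target of any proof and a sufficient lever of any disproof):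
  (a) **Satake rigidity** `satakeRigidity_of_crux`: `HasBaseChangeSatakeAt σ u β₁ → … β₂ → β₁ = β₂`
      at controlled `u` (multiplicity one of the hyperspecial Hecke eigencharacter; Cartier 1979 §IV,
      Mínguez 2011 Thm. 4.1 — NOT in the tree; the line `Sketch` re-derives it by a two-run trick);
  (b) **ℓ-adic unitarity** `satakeIntegrality_of_crux`: `‖ι⁻¹(q_u^{(N-1)/2} b)‖ = 1` for every
      `b ∈ β` and EVERY `ι` (eigenvalues of a compact-image representation are units:
      `FramedRep.norm_eq_one_of_isRoot_charpoly`, new, from the tree's `norm_le_one…` applied to `g`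
      and `g⁻¹`);
  (c) **algebraicity** `satakeAlgebraicity_of_crux`: every `b ∈ β` is ALGEBRAIC over `ℚ` — because
      `Aut(ℂ)` is transitive on transcendentals (`exists_ringEquiv_complex_apply_eq`, from the tree's
      Zarhin lemma) so a transcendental `q^{(N-1)/2} b` has an `ι`-preimage of norm `ℓ⁻¹`
      (`isAlgebraic_of_forall_norm_symm_eq_one`).  (c) is Goldring–Koskivirta Cor. 2.2.2 / Harris'
      rationality of coherent cohomology — genuinely deep for IRREGULAR `σ`; so the crux is at least
      as strong as "Hecke eigenvalues of non-degenerate-LDS cusp forms on `U(N)` are algebraic".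
  Refutation shapes: `crux_false_of_not_satakeRigidity`, `crux_false_of_transcendental_satake`.
* §3 `L`/`P` LOAD-BEARING HYPOTHESES: the five weakenings `Without…` are typed and each implies the
  crux (`L`, monotonicity); NONE is refutable in Lean (same structural reason) and — recorded `P` in
  the docstrings — none is even refuted in print: dropping LDS / `IsTotallyReal F₀` /
  `IsTotallyComplex K` / `finrank = 2` lets in cusp forms with non-algebraic archimedean components
  (Maass-type `σ` on `U(1,1)`), for which non-existence of `r` is EXPECTED but unproved; dropping
  "`ℓ` unramified in `K`, `σ` unramified above `ℓ`" gives a statement still EXPECTED TRUE (the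
  conclusion only concerns `u ∤ ℓ`; known for regular `σ` by HLTT/Shin with no condition at `ℓ`) —
  that hypothesis is load-bearing for Goldring–Koskivirta's METHOD (hyperspecial level at `p` for the
  integral model), not for truth.  `N = 1`: every weakening stays true (CFT).
* §4 `L` SCOPE: `crux ↔ AtPrime 2 ∧ (∀ ℓ > 2, AtPrime ℓ)`; the `ℓ = 2` conjunct is admitted by the
  crux but NOT covered by the cited proof (GK standing assumption `p > 2`, §2.1.3; Pilloni–Stroh 2016
  Cor. 3.13 / Rem. 3.12.1 is the printed substitute) — a faithfulness flag, not a falsity.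
* §5 `L` LINE `Sketch` (lead `prover-line-stmt-Langlands-15129-0`; stubs P2 `stub_heckeFieldFinite`,
  P3 `stub_almostAllUnramified`, K2 `stub_regularDSGalois`, K1 `stub_regularShadows`,
  K3 `stub_algebraValuedLimit`; composition `GaloisRepOfUnitaryLDS_of` PROVED by the lead — no gap):
  K2 is literally `crux + d.IsRegular`, hence implied by the crux (`regularCase_of_crux`) and
  unrefutable unless the crux is; P2 — now the named fact `GoldringKoskivirta2019_heckeFieldFinite` —
  is a COROLLARY of the crux (`heckeFieldFinite_of_crux`, via the proved `exists_hasQlModel_holds`: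
  a model over a finite `E/ℚ_ℓ` carries the Frobenius polynomials), so neither K2 nor P2 carries
  falsity risk independent of the crux; the independent risk of the line sits in P3, K1, K3;
  the factorisation inequality shared by K1/K3 is NOT vacuous: any witness at precision `m ≥ 1` has a
  non-empty family and `δ < 1` (`family_pos_of_factorisation`, `delta_lt_one_of_factorisation`, from
  the constant polynomial `Φ = 1`); P3 is stated for ALL `(F₀, K, cK, N)` (no degree/CM/`cK ≠ 1`
  hypothesis: it speaks about split orthogonal groups `cK = 1` too) but the modulus mismatch is
  absorbed by reparametrising `β` (`P`), so no cheap kill; K3 was checked on paper (the hypothesis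
  forces `P_v` monic of degree `n`, integral, and a compatible system of `𝒪_E/ℓ^m`-valued
  pseudocharacters; `E` finite is used for completeness) — no counterexample found.  No stub broken.

## What a disproof would need (for later seats)
Either (i) a cuspidal LDS `σ` with two distinct base-change multisets at a controlled place, or a
transcendental / non-`ℓ`-unit normalised parameter there (§2) — impossible for genuine `σ`, and no
junk `σ` is constructible (the interface is honest); or (ii) a genuine `σ` whose rigid, algebraic,
integral Frobenius data is provably not Galois — no such argument exists in print for any group.
The live risks are FAITHFULNESS risks (ℓ = 2; the unprinted `U → GU` step at inert unramified `p`;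
HLTT's `BC(Π)_w` convention vs `HasBaseChangeSatakeAt` at `c w ≠ w`), auditable only on paper.
-/

noncomputable section

open scoped BigOperators Polynomial Classical NumberField MatrixGroups Matrix
open Polynomial IsDedekindDomain NumberField Filter
open Literature.NumberTheory.Automorphic Literature.NumberTheory.GaloisRepresentations
open Summit.Langlands.Langlands.Theses.QuadraticWindow (GaloisRepOfUnitaryLDS)

set_option linter.dupNamespace false

namespace Summit.Langlands.Langlands.Cruxes.GaloisRepOfUnitaryLDS.Disproof

/-! ## §1 Anatomy: the crux IS the named literature fact; rank strata -/

/-- The crux is VERBATIM (definitionally) the accepted named fact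
`GoldringKoskivirta2019_galoisRep_unitary` (Goldring–Koskivirta 2019, Thm. 3.5.5, LDS unitary case,
rendered for Mok's quasi-split `U_{K/F₀}(N)`): refuting the crux is refuting that fact. [folklore] -/
theorem crux_iff_fact : GaloisRepOfUnitaryLDS ↔ GoldringKoskivirta2019_galoisRep_unitary := Iff.rfl

/-- The crux at a FIXED rank `N` (all other quantifiers as in the crux). [folklore] -/
def At (N : ℕ) : Prop :=
  ∀ (F₀ K : Type) [Field F₀] [NumberField F₀] [Field K] [NumberField K] [Algebra F₀ K]
    (cK : K ≃ₐ[F₀] K), IsTotallyReal F₀ → Module.finrank F₀ K = 2 → ∀ (hc : cK ≠ 1),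
    IsTotallyComplex K → ∀ (ℓ : ℕ) [Fact ℓ.Prime] (ι : PadicAlgCl ℓ ≃+* ℂ)
    (hcptK : isCompact_glFiniteIntegralLevel N K)
    (σ : UnitaryGroup.CuspidalAutomorphicRepData F₀ K cK N hcptK),
    (∀ (w : {w : InfinitePlace K // w.IsComplex}) (hw : cK • w.1 = w.1),
      ∃ (p q : ℕ) (d : LDSDatum p q),
        UnitaryGroup.IsNondegenerateLimitOfDiscreteSeriesAt F₀ K cK N (StdForm.antidiagonal N)
          hcptK σ.1 hw hc d) →
    (∀ u : HeightOneSpectrum (𝓞 K), ((ℓ : ℕ) : 𝓞 K) ∈ u.asIdeal →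
      u.asIdeal.ramificationIdx ℤ = 1 ∧ UnitaryGroup.IsUnramifiedAt F₀ K cK N hcptK σ.1 u) →
    ∃ r : FramedGaloisRep K (PadicAlgCl ℓ) N, r.toGaloisRep.IsSemisimple ∧
      ∀ (u : HeightOneSpectrum (𝓞 K)) (β : Multiset ℂ), ((ℓ : ℕ) : 𝓞 K) ∉ u.asIdeal →
        (∀ u' : HeightOneSpectrum (𝓞 K), u'.asIdeal.under ℤ = u.asIdeal.under ℤ →
          u'.asIdeal.ramificationIdx ℤ = 1 ∧ UnitaryGroup.IsUnramifiedAt F₀ K cK N hcptK σ.1 u') →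
        UnitaryGroup.HasBaseChangeSatakeAt F₀ K cK N hcptK σ.1 u β →
          r.IsUnramifiedAt u ∧ r.HasFrobCharpolyAt u (arithFrobPolyOfSatake ι u.residueCard N β)

/-- `GaloisRepOfUnitaryLDS ↔ ∀ N, At N` (move the rank quantifier to the front). [folklore] -/
theorem crux_iff_forall_at : GaloisRepOfUnitaryLDS ↔ ∀ N, At N :=
  ⟨fun h N F₀ K _ _ _ _ _ cK hF₀ hK hc hKc ℓ _ ι hcptK σ ↦ h F₀ K cK hF₀ hK hc hKc N ℓ ι hcptK σ,
    fun h F₀ K _ _ _ _ _ cK hF₀ hK hc hKc N ℓ _ ι hcptK σ ↦ h N F₀ K cK hF₀ hK hc hKc ℓ ι hcptK σ⟩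

/-- **The degenerate rank `N = 0` is NOT a counterexample**: `At 0` holds (trivial representation
into `GL_0`; accepted `GoldringKoskivirta2019_galoisRep_unitary_rank_zero`). [folklore] -/
theorem at_zero : At 0 := by
  intro F₀ K _ _ _ _ _ cK _ _ _ _ ℓ _ ι hcptK σ _ _
  obtain ⟨r, hr, hr'⟩ := GoldringKoskivirta2019_galoisRep_unitary_rank_zero F₀ K cK ℓ ι hcptK σ
  exact ⟨r, hr, fun u β _ _ hβ ↦ hr' u β hβ⟩

/-- Hence the crux is equivalent to its restriction to POSITIVE rank: any disproof must use
`0 < N` (and any proof may assume it, cf. `GoldringKoskivirta2019_galoisRep_unitary_of_pos_rank`).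
[folklore] -/
theorem crux_iff_forall_pos : GaloisRepOfUnitaryLDS ↔ ∀ N, 0 < N → At N := by
  rw [crux_iff_forall_at]
  refine ⟨fun h N _ ↦ h N, fun h N ↦ ?_⟩
  obtain _ | N := N
  · exact at_zero
  · exact h (N + 1) N.succ_pos

/-! ## §2 Hidden content of the conclusion's SHAPE

The conclusion is quantified over every `ι : ℚ̄_ℓ ≃+* ℂ` and every `β` with
`HasBaseChangeSatakeAt σ u β` at a controlled `u`; three consequences follow formally. -/

/-! ### §2.0 Tools (general; new in the tree) -/

section Tools

variable {G : Type*} [Group G] [TopologicalSpace G] [CompactSpace G]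
variable {A : Type*} [NormedField A] {n : ℕ}

/-- **Eigenvalues of a compact-image representation are units**: for a continuous
`ρ : G → GL_n(A)` of a compact group over a normed field, every root `μ` of `charpoly ρ(g)` has
`‖μ‖ = 1` (the tree's `FramedRep.norm_le_one_of_isRoot_charpoly` gives `≤ 1`; apply it also to
`g⁻¹`, whose matrix has the eigenvector of `μ` with eigenvalue `μ⁻¹`). Serre 1968, Ch. I §1.1.
[folklore] -/
theorem FramedRep.norm_eq_one_of_isRoot_charpoly (ρ : FramedRep G A n) (g : G) {μ : A}
    (hμ : (FramedRep.charpoly ρ g).IsRoot μ) : ‖μ‖ = 1 := by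
  refine le_antisymm (FramedRep.norm_le_one_of_isRoot_charpoly ρ g hμ) ?_
  set M : Matrix (Fin n) (Fin n) A := ((ρ g : GL (Fin n) A) : Matrix (Fin n) (Fin n) A) with hM
  set M' : Matrix (Fin n) (Fin n) A := ((ρ g⁻¹ : GL (Fin n) A) : Matrix (Fin n) (Fin n) A) with hM'
  have hM'M : M' * M = 1 := by
    rw [hM, hM', map_inv, ← Units.val_mul, inv_mul_cancel, Units.val_one]
  have hev : Module.End.HasEigenvalue (Matrix.toLin' M) μ := by
    rw [Module.End.hasEigenvalue_iff_isRoot_charpoly, Matrix.charpoly_toLin']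
    exact hμ
  obtain ⟨v, hv⟩ := hev.exists_hasEigenvector
  have hv0 : v ≠ 0 := hv.2
  have hMv : M *ᵥ v = μ • v := by
    have h := hv.apply_eq_smul
    rwa [Matrix.toLin'_apply] at h
  have hback : M' *ᵥ (M *ᵥ v) = v := by
    rw [Matrix.mulVec_mulVec, hM'M, Matrix.one_mulVec]
  have hμ0 : μ ≠ 0 := by
    intro h0
    apply hv0
    rw [← hback, hMv, h0, zero_smul, Matrix.mulVec_zero]
  have hM'v : M' *ᵥ v = μ⁻¹ • v := by
    rw [hMv, Matrix.mulVec_smul] at hback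
    calc M' *ᵥ v = μ⁻¹ • (μ • (M' *ᵥ v)) := by rw [smul_smul, inv_mul_cancel₀ hμ0, one_smul]
      _ = μ⁻¹ • v := by rw [hback]
  have hev' : Module.End.HasEigenvalue (Matrix.toLin' M') μ⁻¹ :=
    Module.End.hasEigenvalue_of_hasEigenvector
      ⟨Module.End.mem_eigenspace_iff.mpr (by rw [Matrix.toLin'_apply, hM'v]), hv0⟩
  have hroot' : (FramedRep.charpoly ρ g⁻¹).IsRoot μ⁻¹ := by
    rw [Module.End.hasEigenvalue_iff_isRoot_charpoly, Matrix.charpoly_toLin'] at hev'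
    exact hev'
  have h1 := FramedRep.norm_le_one_of_isRoot_charpoly ρ g⁻¹ hroot'
  rw [norm_inv] at h1
  exact (inv_le_one₀ (norm_pos_iff.mpr hμ0)).mp h1

end Tools

section AutC

/-- **`Aut(ℂ)` is transitive on transcendental numbers**: for `x, y ∈ ℂ` transcendental over `ℚ`
there is a field automorphism `τ` of `ℂ` with `τ x = y` (both give embeddings `ℚ(X) ↪ ℂ` of the
countable field `ℚ(X)`; the tree's `ZarhinLie.exists_ringEquiv_complex_comp_eq` conjugates them).
Bourbaki, Algèbre V §14 no. 6 Cor. 2. [folklore] -/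
theorem exists_ringEquiv_complex_apply_eq {x y : ℂ} (hx : Transcendental ℚ x)
    (hy : Transcendental ℚ y) : ∃ τ : ℂ ≃+* ℂ, τ x = y := by
  haveI : Countable ℚ[X] := Cardinal.mk_le_aleph0_iff.mp
    (Polynomial.cardinalMk_le_max.trans (by rw [Cardinal.mk_eq_aleph0, max_self]))
  haveI : Countable (RatFunc ℚ) :=
    Function.Surjective.countable (f := fun pq : ℚ[X] × ℚ[X] =>
      algebraMap ℚ[X] (RatFunc ℚ) pq.1 / algebraMap ℚ[X] (RatFunc ℚ) pq.2)
      fun f => ⟨(f.num, f.denom), RatFunc.num_div_denom f⟩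
  have emb : ∀ z : ℂ, Transcendental ℚ z → ∃ σ : RatFunc ℚ →+* ℂ, σ RatFunc.X = z := by
    intro z hz
    have hinj : Function.Injective (Polynomial.aeval (R := ℚ) z) :=
      transcendental_iff_injective.mp hz
    have hφ : nonZeroDivisors ℚ[X] ≤
        (nonZeroDivisors ℂ).comap ((Polynomial.aeval (R := ℚ) z).toRingHom) := by
      intro p hp
      rw [Submonoid.mem_comap]
      refine mem_nonZeroDivisors_of_ne_zero fun h0 => nonZeroDivisors.ne_zero hp (hinj ?_)
      rw [map_zero]
      exact h0
    refine ⟨RatFunc.liftRingHom _ hφ, ?_⟩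
    rw [RatFunc.liftRingHom_X]
    simp
  obtain ⟨σ₀, h₀⟩ := emb x hx
  obtain ⟨σ₁, h₁⟩ := emb y hy
  obtain ⟨τ, hτ⟩ :=
    Literature.AlgebraicGeometry.Motives.ZarhinLie.exists_ringEquiv_complex_comp_eq σ₀ σ₁
  exact ⟨τ, by rw [← h₀, hτ, h₁]⟩

/-- `‖ℓ‖ < 1` in `ℚ̄_ℓ` (Mathlib `PadicAlgCl.valuation_p`). [folklore] -/
theorem norm_natCast_padicAlgCl_lt_one (ℓ : ℕ) [Fact ℓ.Prime] : ‖(ℓ : PadicAlgCl ℓ)‖ < 1 := by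
  have h : ‖(ℓ : PadicAlgCl ℓ)‖₊ = 1 / (ℓ : NNReal) := by
    rw [← PadicAlgCl.valuation_def]; exact PadicAlgCl.valuation_p ℓ
  have hℓ : (1 : NNReal) < ℓ := by exact_mod_cast (Fact.out : ℓ.Prime).one_lt
  have : ‖(ℓ : PadicAlgCl ℓ)‖₊ < 1 := by
    rw [h, one_div]; exact inv_lt_one_of_one_lt₀ hℓ
  exact_mod_cast this

/-- **A complex number all of whose `ι`-preimages in `ℚ̄_ℓ` are `ℓ`-adic units is algebraic**:
if `x` were transcendental, so would be `ℓ x`, an automorphism `τ` of `ℂ` with `τ (ℓ x) = x`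
exists (`exists_ringEquiv_complex_apply_eq`), and for `ι' = τ ∘ ι` one gets
`ι'⁻¹(x) = ℓ · ι⁻¹(x)`, of norm `ℓ⁻¹ ≠ 1`. [folklore] -/
theorem isAlgebraic_of_forall_norm_symm_eq_one {ℓ : ℕ} [Fact ℓ.Prime] {x : ℂ}
    (h : ∀ ι : PadicAlgCl ℓ ≃+* ℂ, ‖ι.symm x‖ = 1) : IsAlgebraic ℚ x := by
  by_contra hx
  have hℓ0 : (ℓ : ℂ) ≠ 0 := Nat.cast_ne_zero.mpr (Fact.out : ℓ.Prime).ne_zero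
  have hℓalg : IsAlgebraic ℚ (ℓ : ℂ) := by
    simpa using isAlgebraic_algebraMap (R := ℚ) (A := ℂ) (ℓ : ℚ)
  have hℓx : Transcendental ℚ ((ℓ : ℂ) * x) := fun halg =>
    hx (IsAlgebraic.of_mul (mem_nonZeroDivisors_of_ne_zero hℓ0) hℓalg halg)
  obtain ⟨τ, hτ⟩ := exists_ringEquiv_complex_apply_eq hℓx hx
  obtain ⟨ι⟩ := PadicAlgCl.nonempty_ringEquiv_complex ℓ
  have h1 := h ι
  have h2 := h (ι.trans τ)
  have e : (ι.trans τ).symm x = (ℓ : PadicAlgCl ℓ) * ι.symm x := by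
    have hτ' : τ.symm x = (ℓ : ℂ) * x := by rw [RingEquiv.symm_apply_eq]; exact hτ.symm
    change ι.symm (τ.symm x) = _
    rw [hτ', map_mul, map_natCast]
  rw [e, norm_mul, h1, mul_one] at h2
  exact (norm_natCast_padicAlgCl_lt_one ℓ).ne h2

/-- `√q` (as a complex number) is algebraic over `ℚ`, and so are its powers. [folklore] -/
theorem isAlgebraic_sqrt_pow (q e : ℕ) : IsAlgebraic ℚ ((((Real.sqrt q : ℝ)) : ℂ) ^ e) := by
  refine IsAlgebraic.pow ?_ e
  refine ⟨X ^ 2 - C (q : ℚ), ?_, ?_⟩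
  · intro h0
    have := congrArg (fun P : ℚ[X] => P.coeff 2) h0
    simp [coeff_X_pow] at this
  · have hsq : (((Real.sqrt q : ℝ)) : ℂ) ^ 2 = (q : ℂ) := by
      rw [← Complex.ofReal_pow, Real.sq_sqrt (Nat.cast_nonneg q)]; simp
    simp [hsq]

end AutC

/-! ### §2.1 Satake rigidity (multiplicity one) -/

/-- Two Frobenius characteristic polynomials of one framed representation at one place of a number
field coincide (a prime above `u` exists and carries an arithmetic Frobenius: tree theorems
`HeightOneSpectrum.primesAbove_nonempty`, `exists_isArithFrobAt_of_mem_primesAbove_holds`).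
[folklore] -/
theorem hasFrobCharpolyAt_unique {K : Type} [Field K] [NumberField K] {A : Type*} [CommRing A]
    [TopologicalSpace A] {n : ℕ} (r : FramedGaloisRep K A n) {u : HeightOneSpectrum (𝓞 K)}
    {P Q : A[X]} (hP : r.HasFrobCharpolyAt u P) (hQ : r.HasFrobCharpolyAt u Q) : P = Q := by
  obtain ⟨𝔓, h𝔓⟩ := HeightOneSpectrum.primesAbove_nonempty u
  obtain ⟨φ, hφ⟩ := HeightOneSpectrum.exists_isArithFrobAt_of_mem_primesAbove_holds h𝔓
  rw [← hP 𝔓 h𝔓 φ hφ, ← hQ 𝔓 h𝔓 φ hφ]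

/-- **Satake rigidity on the control set** (the statement): for `σ` as in the crux, at every
controlled place `u` the base-change Satake parameter of `σ` is UNIQUE as a multiset.  An
automorphic statement (Satake isomorphism for the hyperspecial Hecke algebra of `U_{K/F₀}(N)_v`,
Cartier 1979 §IV / Mínguez 2011 Thm. 4.1, plus irreducibility of `σ`) that is NOT separately
recorded in the tree, and which the crux IMPLIES (`satakeRigidity_of_crux`). [folklore] -/
def SatakeRigidity : Prop :=
  ∀ (F₀ K : Type) [Field F₀] [NumberField F₀] [Field K] [NumberField K] [Algebra F₀ K]
    (cK : K ≃ₐ[F₀] K), IsTotallyReal F₀ → Module.finrank F₀ K = 2 → ∀ (hc : cK ≠ 1),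
    IsTotallyComplex K → ∀ (N : ℕ) (ℓ : ℕ) [Fact ℓ.Prime]
    (hcptK : isCompact_glFiniteIntegralLevel N K)
    (σ : UnitaryGroup.CuspidalAutomorphicRepData F₀ K cK N hcptK),
    (∀ (w : {w : InfinitePlace K // w.IsComplex}) (hw : cK • w.1 = w.1),
      ∃ (p q : ℕ) (d : LDSDatum p q),
        UnitaryGroup.IsNondegenerateLimitOfDiscreteSeriesAt F₀ K cK N (StdForm.antidiagonal N)
          hcptK σ.1 hw hc d) →
    (∀ u : HeightOneSpectrum (𝓞 K), ((ℓ : ℕ) : 𝓞 K) ∈ u.asIdeal →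
      u.asIdeal.ramificationIdx ℤ = 1 ∧ UnitaryGroup.IsUnramifiedAt F₀ K cK N hcptK σ.1 u) →
    ∀ (u : HeightOneSpectrum (𝓞 K)) (β₁ β₂ : Multiset ℂ), ((ℓ : ℕ) : 𝓞 K) ∉ u.asIdeal →
      (∀ u' : HeightOneSpectrum (𝓞 K), u'.asIdeal.under ℤ = u.asIdeal.under ℤ →
        u'.asIdeal.ramificationIdx ℤ = 1 ∧ UnitaryGroup.IsUnramifiedAt F₀ K cK N hcptK σ.1 u') →
      UnitaryGroup.HasBaseChangeSatakeAt F₀ K cK N hcptK σ.1 u β₁ →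
      UnitaryGroup.HasBaseChangeSatakeAt F₀ K cK N hcptK σ.1 u β₂ → β₁ = β₂

/-- **The crux implies Satake rigidity on its control set.**  Instantiate the crux at any
`ι : ℚ̄_ℓ ≃+* ℂ` (`PadicAlgCl.nonempty_ringEquiv_complex`); the predicted polynomials of `β₁, β₂`
are Frobenius polynomials of the same `r` at the same `u`, hence equal, and the dictionary
`arithFrobPolyOfSatake ι q N` is injective (`q_u > 0`). [folklore] -/
theorem satakeRigidity_of_crux (h : GaloisRepOfUnitaryLDS) : SatakeRigidity := by
  intro F₀ K _ _ _ _ _ cK hF₀ hK hc hKc N ℓ _ hcptK σ hLDS hℓ u β₁ β₂ hu hu' h₁ h₂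
  obtain ⟨ι⟩ := PadicAlgCl.nonempty_ringEquiv_complex ℓ
  obtain ⟨r, -, hr⟩ := h F₀ K cK hF₀ hK hc hKc N ℓ ι hcptK σ hLDS hℓ
  have e := hasFrobCharpolyAt_unique r (hr u β₁ hu hu' h₁).2 (hr u β₂ hu hu' h₂).2
  exact arithFrobPolyOfSatake_injective ι (zero_lt_one.trans u.one_lt_residueCard) N e

/-- Refutation shape: a failure of Satake rigidity for some cuspidal LDS `σ` at a controlled place
kills the crux. [folklore] -/
theorem crux_false_of_not_satakeRigidity (h : ¬ SatakeRigidity) : ¬ GaloisRepOfUnitaryLDS :=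
  fun hc ↦ h (satakeRigidity_of_crux hc)

/-! ### §2.2 `ℓ`-adic unitarity of the normalised parameters, for EVERY `ι` -/

/-- **Satake integrality** (the statement): for `σ` as in the crux, every `ι`, every controlled `u`
and every base-change parameter `β` there, each normalised entry `q_u^{(N-1)/2} b`, `b ∈ β`, is sent
by `ι⁻¹` to an `ℓ`-ADIC UNIT of `ℚ̄_ℓ`. [folklore] -/
def SatakeIntegrality : Prop :=
  ∀ (F₀ K : Type) [Field F₀] [NumberField F₀] [Field K] [NumberField K] [Algebra F₀ K]
    (cK : K ≃ₐ[F₀] K), IsTotallyReal F₀ → Module.finrank F₀ K = 2 → ∀ (hc : cK ≠ 1),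
    IsTotallyComplex K → ∀ (N : ℕ) (ℓ : ℕ) [Fact ℓ.Prime] (ι : PadicAlgCl ℓ ≃+* ℂ)
    (hcptK : isCompact_glFiniteIntegralLevel N K)
    (σ : UnitaryGroup.CuspidalAutomorphicRepData F₀ K cK N hcptK),
    (∀ (w : {w : InfinitePlace K // w.IsComplex}) (hw : cK • w.1 = w.1),
      ∃ (p q : ℕ) (d : LDSDatum p q),
        UnitaryGroup.IsNondegenerateLimitOfDiscreteSeriesAt F₀ K cK N (StdForm.antidiagonal N)
          hcptK σ.1 hw hc d) →
    (∀ u : HeightOneSpectrum (𝓞 K), ((ℓ : ℕ) : 𝓞 K) ∈ u.asIdeal →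
      u.asIdeal.ramificationIdx ℤ = 1 ∧ UnitaryGroup.IsUnramifiedAt F₀ K cK N hcptK σ.1 u) →
    ∀ (u : HeightOneSpectrum (𝓞 K)) (β : Multiset ℂ), ((ℓ : ℕ) : 𝓞 K) ∉ u.asIdeal →
      (∀ u' : HeightOneSpectrum (𝓞 K), u'.asIdeal.under ℤ = u.asIdeal.under ℤ →
        u'.asIdeal.ramificationIdx ℤ = 1 ∧ UnitaryGroup.IsUnramifiedAt F₀ K cK N hcptK σ.1 u') →
      UnitaryGroup.HasBaseChangeSatakeAt F₀ K cK N hcptK σ.1 u β →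
      ∀ b ∈ β, ‖ι.symm ((((Real.sqrt (u.residueCard : ℝ) : ℝ)) : ℂ) ^ (N - 1) * b)‖ = 1

/-- **The crux implies `ℓ`-adic unitarity of the normalised base-change parameters, for every `ι`.**
The predicted polynomial is the characteristic polynomial of `r(Frob_u)`; its roots
`ι⁻¹((q^{(N-1)/2} b)⁻¹)` are eigenvalues of a compact-image representation, hence units
(`FramedRep.norm_eq_one_of_isRoot_charpoly`). [folklore] -/
theorem satakeIntegrality_of_crux (h : GaloisRepOfUnitaryLDS) : SatakeIntegrality := by
  intro F₀ K _ _ _ _ _ cK hF₀ hK hc hKc N ℓ _ ι hcptK σ hLDS hℓ u β hu hu' hβ b hb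
  obtain ⟨r, -, hr⟩ := h F₀ K cK hF₀ hK hc hKc N ℓ ι hcptK σ hLDS hℓ
  obtain ⟨𝔓, h𝔓⟩ := HeightOneSpectrum.primesAbove_nonempty u
  obtain ⟨φ, hφ⟩ := HeightOneSpectrum.exists_isArithFrobAt_of_mem_primesAbove_holds h𝔓
  have hchar : FramedRep.charpoly r φ = arithFrobPolyOfSatake ι u.residueCard N β :=
    (hr u β hu hu' hβ).2 𝔓 h𝔓 φ hφ
  set c : ℂ := (((Real.sqrt (u.residueCard : ℝ) : ℝ)) : ℂ) ^ (N - 1) with hc_def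
  have hmem : ι.symm (c * b)⁻¹ ∈ (FramedRep.charpoly r φ).roots := by
    rw [hchar, roots_arithFrobPolyOfSatake]
    exact Multiset.mem_map_of_mem _ hb
  have hroot : (FramedRep.charpoly r φ).IsRoot (ι.symm (c * b)⁻¹) := isRoot_of_mem_roots hmem
  haveI : CompactSpace (Field.absoluteGaloisGroup K) := absoluteGaloisGroup_compactSpace K
  have h1 := FramedRep.norm_eq_one_of_isRoot_charpoly r φ hroot
  rwa [map_inv₀, norm_inv, inv_eq_one] at h1

/-! ### §2.3 Algebraicity of the base-change Satake parameters -/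

/-- **Satake algebraicity** (the statement): for `σ` as in the crux, at every controlled `u`, every
entry of every base-change Satake parameter `β` of `σ` is an ALGEBRAIC number.  For irregular
(limit of discrete series) `σ` this is a deep theorem in print (Goldring–Koskivirta 2019,
Cor. 2.2.2: `π_f` is defined over a number field, via Harris' rational structure on coherent
cohomology); the crux CONTAINS it (`satakeAlgebraicity_of_crux`). [folklore] -/
def SatakeAlgebraicity : Prop :=
  ∀ (F₀ K : Type) [Field F₀] [NumberField F₀] [Field K] [NumberField K] [Algebra F₀ K]
    (cK : K ≃ₐ[F₀] K), IsTotallyReal F₀ → Module.finrank F₀ K = 2 → ∀ (hc : cK ≠ 1),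
    IsTotallyComplex K → ∀ (N : ℕ) (ℓ : ℕ) [Fact ℓ.Prime]
    (hcptK : isCompact_glFiniteIntegralLevel N K)
    (σ : UnitaryGroup.CuspidalAutomorphicRepData F₀ K cK N hcptK),
    (∀ (w : {w : InfinitePlace K // w.IsComplex}) (hw : cK • w.1 = w.1),
      ∃ (p q : ℕ) (d : LDSDatum p q),
        UnitaryGroup.IsNondegenerateLimitOfDiscreteSeriesAt F₀ K cK N (StdForm.antidiagonal N)
          hcptK σ.1 hw hc d) →
    (∀ u : HeightOneSpectrum (𝓞 K), ((ℓ : ℕ) : 𝓞 K) ∈ u.asIdeal →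
      u.asIdeal.ramificationIdx ℤ = 1 ∧ UnitaryGroup.IsUnramifiedAt F₀ K cK N hcptK σ.1 u) →
    ∀ (u : HeightOneSpectrum (𝓞 K)) (β : Multiset ℂ), ((ℓ : ℕ) : 𝓞 K) ∉ u.asIdeal →
      (∀ u' : HeightOneSpectrum (𝓞 K), u'.asIdeal.under ℤ = u.asIdeal.under ℤ →
        u'.asIdeal.ramificationIdx ℤ = 1 ∧ UnitaryGroup.IsUnramifiedAt F₀ K cK N hcptK σ.1 u') →
      UnitaryGroup.HasBaseChangeSatakeAt F₀ K cK N hcptK σ.1 u β →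
      ∀ b ∈ β, IsAlgebraic ℚ b

/-- **The crux implies algebraicity of the base-change Satake parameters on the control set.**
By `satakeIntegrality_of_crux` the number `x = q^{(N-1)/2} b` has `‖ι⁻¹ x‖ = 1` for EVERY `ι`, so
`x` is algebraic (`isAlgebraic_of_forall_norm_symm_eq_one`), and `q^{(N-1)/2} ≠ 0` is algebraic.
Refutation shape: ONE transcendental base-change Satake entry at ONE controlled place of ONE
cuspidal non-degenerate-LDS `σ` refutes the crux (`crux_false_of_transcendental_satake`). [folklore] -/
theorem satakeAlgebraicity_of_crux (h : GaloisRepOfUnitaryLDS) : SatakeAlgebraicity := by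
  intro F₀ K _ _ _ _ _ cK hF₀ hK hc hKc N ℓ _ hcptK σ hLDS hℓ u β hu hu' hβ b hb
  set c : ℂ := (((Real.sqrt (u.residueCard : ℝ) : ℝ)) : ℂ) ^ (N - 1) with hc_def
  have hx : IsAlgebraic ℚ (c * b) := isAlgebraic_of_forall_norm_symm_eq_one (ℓ := ℓ) fun ι ↦
    satakeIntegrality_of_crux h F₀ K cK hF₀ hK hc hKc N ℓ ι hcptK σ hLDS hℓ u β hu hu' hβ b hb
  have hc0 : c ≠ 0 := pow_ne_zero _ (sqrt_residueCard_ne_zero u)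
  exact IsAlgebraic.of_mul (mem_nonZeroDivisors_of_ne_zero hc0) (isAlgebraic_sqrt_pow _ _) hx

/-- Refutation shape for §2.3. [folklore] -/
theorem crux_false_of_transcendental_satake (h : ¬ SatakeAlgebraicity) : ¬ GaloisRepOfUnitaryLDS :=
  fun hc ↦ h (satakeAlgebraicity_of_crux hc)

/-- Summary of §2: the crux carries Satake rigidity, `ℓ`-adic unitarity and algebraicity of the
base-change Satake parameters of non-degenerate-LDS cusp forms on its control set. [folklore] -/
theorem hidden_content_of_crux (h : GaloisRepOfUnitaryLDS) :
    SatakeRigidity ∧ SatakeIntegrality ∧ SatakeAlgebraicity :=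
  ⟨satakeRigidity_of_crux h, satakeIntegrality_of_crux h, satakeAlgebraicity_of_crux h⟩


/-! ## §3 Load-bearing hypotheses: the weakenings, typed

Each `Without…` is the crux with ONE hypothesis dropped; each IMPLIES the crux (monotonicity,
proved), none is refutable in Lean (a counterexample needs a genuine cuspidal `σ`), and the
docstrings record the paper status.  Convention: the dropped hypothesis is named in the
identifier. -/

/-- **Crux WITHOUT the archimedean (non-degenerate LDS) hypothesis.**  Paper status: EXPECTED
FALSE for `N ≥ 2` — it asserts `ℓ`-adic Galois representations with Satake–Frobenius matching
for EVERY cuspidal `σ` on `U_{K/F₀}(N)` unramified above `ℓ`, including those whose archimedean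
components have non-integral infinitesimal character (Maass-type cusp forms on the quasi-split
`U(1,1) = U_{K/F₀}(2)`, whose base change to `GL_2/K` has Laplace-type parameters); by §2 it would
force their Hecke eigenvalues to be algebraic, which is expected to fail but is OPEN (no
transcendence result for Maass eigenvalues is known).  TRUE for `N ≤ 1` (every automorphic
character of the compact torus `U(1)(F₀ ⊗ ℝ) = (S¹)^{[F₀:ℚ]}` is algebraic; CFT).  Not refutable
in Lean. [folklore] -/
def WithoutLDS : Prop :=
  ∀ (F₀ K : Type) [Field F₀] [NumberField F₀] [Field K] [NumberField K] [Algebra F₀ K]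
    (cK : K ≃ₐ[F₀] K), IsTotallyReal F₀ → Module.finrank F₀ K = 2 → cK ≠ 1 →
    IsTotallyComplex K → ∀ (N : ℕ) (ℓ : ℕ) [Fact ℓ.Prime] (ι : PadicAlgCl ℓ ≃+* ℂ)
    (hcptK : isCompact_glFiniteIntegralLevel N K)
    (σ : UnitaryGroup.CuspidalAutomorphicRepData F₀ K cK N hcptK),
    (∀ u : HeightOneSpectrum (𝓞 K), ((ℓ : ℕ) : 𝓞 K) ∈ u.asIdeal →
      u.asIdeal.ramificationIdx ℤ = 1 ∧ UnitaryGroup.IsUnramifiedAt F₀ K cK N hcptK σ.1 u) →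
    ∃ r : FramedGaloisRep K (PadicAlgCl ℓ) N, r.toGaloisRep.IsSemisimple ∧
      ∀ (u : HeightOneSpectrum (𝓞 K)) (β : Multiset ℂ), ((ℓ : ℕ) : 𝓞 K) ∉ u.asIdeal →
        (∀ u' : HeightOneSpectrum (𝓞 K), u'.asIdeal.under ℤ = u.asIdeal.under ℤ →
          u'.asIdeal.ramificationIdx ℤ = 1 ∧ UnitaryGroup.IsUnramifiedAt F₀ K cK N hcptK σ.1 u') →
        UnitaryGroup.HasBaseChangeSatakeAt F₀ K cK N hcptK σ.1 u β →
          r.IsUnramifiedAt u ∧ r.HasFrobCharpolyAt u (arithFrobPolyOfSatake ι u.residueCard N β)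

/-- Monotonicity: the LDS-free statement implies the crux. [folklore] -/
theorem crux_of_withoutLDS (h : WithoutLDS) : GaloisRepOfUnitaryLDS :=
  fun F₀ K _ _ _ _ _ cK hF₀ hK hc hKc N ℓ _ ι hcptK σ _ hℓ ↦ h F₀ K cK hF₀ hK hc hKc N ℓ ι hcptK σ hℓ

/-- **Crux WITHOUT "`ℓ` unramified in `K` and `σ` hyperspecial-unramified above `ℓ`".**  Paper
status: EXPECTED TRUE (!) — the conclusion only concerns controlled places `u ∤ ℓ`, and the
Galois representation of `σ` should exist for every `ℓ`; for REGULAR discrete series `σ` this is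
Harris–Lan–Taylor–Thorne / Shin (no condition at `ℓ`).  For irregular `σ` it is OPEN in print:
Goldring–Koskivirta's method needs `p = ℓ ∉ Ram(G) ∪ Ram(π)` (smooth integral model at hyperspecial
level, §2.1.3–2.4), as do Pilloni–Stroh and Boxer–Pilloni.  So this hypothesis is load-bearing for
the METHOD, not for the truth of the statement: a proof of the crux that does not use it would be
strictly stronger than the literature.  Not refutable in Lean. [folklore] -/
def WithoutGoodEll : Prop :=
  ∀ (F₀ K : Type) [Field F₀] [NumberField F₀] [Field K] [NumberField K] [Algebra F₀ K]
    (cK : K ≃ₐ[F₀] K), IsTotallyReal F₀ → Module.finrank F₀ K = 2 → ∀ (hc : cK ≠ 1),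
    IsTotallyComplex K → ∀ (N : ℕ) (ℓ : ℕ) [Fact ℓ.Prime] (ι : PadicAlgCl ℓ ≃+* ℂ)
    (hcptK : isCompact_glFiniteIntegralLevel N K)
    (σ : UnitaryGroup.CuspidalAutomorphicRepData F₀ K cK N hcptK),
    (∀ (w : {w : InfinitePlace K // w.IsComplex}) (hw : cK • w.1 = w.1),
      ∃ (p q : ℕ) (d : LDSDatum p q),
        UnitaryGroup.IsNondegenerateLimitOfDiscreteSeriesAt F₀ K cK N (StdForm.antidiagonal N)
          hcptK σ.1 hw hc d) →
    ∃ r : FramedGaloisRep K (PadicAlgCl ℓ) N, r.toGaloisRep.IsSemisimple ∧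
      ∀ (u : HeightOneSpectrum (𝓞 K)) (β : Multiset ℂ), ((ℓ : ℕ) : 𝓞 K) ∉ u.asIdeal →
        (∀ u' : HeightOneSpectrum (𝓞 K), u'.asIdeal.under ℤ = u.asIdeal.under ℤ →
          u'.asIdeal.ramificationIdx ℤ = 1 ∧ UnitaryGroup.IsUnramifiedAt F₀ K cK N hcptK σ.1 u') →
        UnitaryGroup.HasBaseChangeSatakeAt F₀ K cK N hcptK σ.1 u β →
          r.IsUnramifiedAt u ∧ r.HasFrobCharpolyAt u (arithFrobPolyOfSatake ι u.residueCard N β)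

/-- Monotonicity. [folklore] -/
theorem crux_of_withoutGoodEll (h : WithoutGoodEll) : GaloisRepOfUnitaryLDS :=
  fun F₀ K _ _ _ _ _ cK hF₀ hK hc hKc N ℓ _ ι hcptK σ hLDS _ ↦
    h F₀ K cK hF₀ hK hc hKc N ℓ ι hcptK σ hLDS

/-- **Crux WITHOUT `IsTotallyReal F₀`.**  Paper status: EXPECTED FALSE — if `F₀` has a complex
place `v`, the two places of `K` above `v` are swapped by `cK`, so the LDS hypothesis (stated at
`cK`-FIXED complex places only) says nothing at `v`, where `U(F₀,v) ≅ GL_N(ℂ)` and `σ_v` may be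
non-algebraic; §2 would make its Hecke eigenvalues algebraic.  Open, not refutable in Lean.
[folklore] -/
def WithoutTotallyReal : Prop :=
  ∀ (F₀ K : Type) [Field F₀] [NumberField F₀] [Field K] [NumberField K] [Algebra F₀ K]
    (cK : K ≃ₐ[F₀] K), Module.finrank F₀ K = 2 → ∀ (hc : cK ≠ 1),
    IsTotallyComplex K → ∀ (N : ℕ) (ℓ : ℕ) [Fact ℓ.Prime] (ι : PadicAlgCl ℓ ≃+* ℂ)
    (hcptK : isCompact_glFiniteIntegralLevel N K)
    (σ : UnitaryGroup.CuspidalAutomorphicRepData F₀ K cK N hcptK),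
    (∀ (w : {w : InfinitePlace K // w.IsComplex}) (hw : cK • w.1 = w.1),
      ∃ (p q : ℕ) (d : LDSDatum p q),
        UnitaryGroup.IsNondegenerateLimitOfDiscreteSeriesAt F₀ K cK N (StdForm.antidiagonal N)
          hcptK σ.1 hw hc d) →
    (∀ u : HeightOneSpectrum (𝓞 K), ((ℓ : ℕ) : 𝓞 K) ∈ u.asIdeal →
      u.asIdeal.ramificationIdx ℤ = 1 ∧ UnitaryGroup.IsUnramifiedAt F₀ K cK N hcptK σ.1 u) →
    ∃ r : FramedGaloisRep K (PadicAlgCl ℓ) N, r.toGaloisRep.IsSemisimple ∧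
      ∀ (u : HeightOneSpectrum (𝓞 K)) (β : Multiset ℂ), ((ℓ : ℕ) : 𝓞 K) ∉ u.asIdeal →
        (∀ u' : HeightOneSpectrum (𝓞 K), u'.asIdeal.under ℤ = u.asIdeal.under ℤ →
          u'.asIdeal.ramificationIdx ℤ = 1 ∧ UnitaryGroup.IsUnramifiedAt F₀ K cK N hcptK σ.1 u') →
        UnitaryGroup.HasBaseChangeSatakeAt F₀ K cK N hcptK σ.1 u β →
          r.IsUnramifiedAt u ∧ r.HasFrobCharpolyAt u (arithFrobPolyOfSatake ι u.residueCard N β)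

/-- Monotonicity. [folklore] -/
theorem crux_of_withoutTotallyReal (h : WithoutTotallyReal) : GaloisRepOfUnitaryLDS :=
  fun F₀ K _ _ _ _ _ cK _ hK hc hKc N ℓ _ ι hcptK σ hLDS hℓ ↦
    h F₀ K cK hK hc hKc N ℓ ι hcptK σ hLDS hℓ

/-- **Crux WITHOUT `IsTotallyComplex K`.**  Paper status: EXPECTED FALSE — for `K/F₀` a real
quadratic extension, `U_{K/F₀}(N)(F₀ ⊗ ℝ) = ∏ GL_N(ℝ)` and `K` has no complex place, so the LDS
hypothesis is vacuous and non-algebraic cusp forms enter; §2 as above.  Open, not refutable in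
Lean.  (For `K` of mixed signature the real places of `K` come in `cK`-swapped pairs over split
real `v`, again unconstrained.) [folklore] -/
def WithoutTotallyComplex : Prop :=
  ∀ (F₀ K : Type) [Field F₀] [NumberField F₀] [Field K] [NumberField K] [Algebra F₀ K]
    (cK : K ≃ₐ[F₀] K), IsTotallyReal F₀ → Module.finrank F₀ K = 2 → ∀ (hc : cK ≠ 1),
    ∀ (N : ℕ) (ℓ : ℕ) [Fact ℓ.Prime] (ι : PadicAlgCl ℓ ≃+* ℂ)
    (hcptK : isCompact_glFiniteIntegralLevel N K)
    (σ : UnitaryGroup.CuspidalAutomorphicRepData F₀ K cK N hcptK),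
    (∀ (w : {w : InfinitePlace K // w.IsComplex}) (hw : cK • w.1 = w.1),
      ∃ (p q : ℕ) (d : LDSDatum p q),
        UnitaryGroup.IsNondegenerateLimitOfDiscreteSeriesAt F₀ K cK N (StdForm.antidiagonal N)
          hcptK σ.1 hw hc d) →
    (∀ u : HeightOneSpectrum (𝓞 K), ((ℓ : ℕ) : 𝓞 K) ∈ u.asIdeal →
      u.asIdeal.ramificationIdx ℤ = 1 ∧ UnitaryGroup.IsUnramifiedAt F₀ K cK N hcptK σ.1 u) →
    ∃ r : FramedGaloisRep K (PadicAlgCl ℓ) N, r.toGaloisRep.IsSemisimple ∧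
      ∀ (u : HeightOneSpectrum (𝓞 K)) (β : Multiset ℂ), ((ℓ : ℕ) : 𝓞 K) ∉ u.asIdeal →
        (∀ u' : HeightOneSpectrum (𝓞 K), u'.asIdeal.under ℤ = u.asIdeal.under ℤ →
          u'.asIdeal.ramificationIdx ℤ = 1 ∧ UnitaryGroup.IsUnramifiedAt F₀ K cK N hcptK σ.1 u') →
        UnitaryGroup.HasBaseChangeSatakeAt F₀ K cK N hcptK σ.1 u β →
          r.IsUnramifiedAt u ∧ r.HasFrobCharpolyAt u (arithFrobPolyOfSatake ι u.residueCard N β)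

/-- Monotonicity. [folklore] -/
theorem crux_of_withoutTotallyComplex (h : WithoutTotallyComplex) : GaloisRepOfUnitaryLDS :=
  fun F₀ K _ _ _ _ _ cK hF₀ hK hc _ N ℓ _ ι hcptK σ hLDS hℓ ↦
    h F₀ K cK hF₀ hK hc N ℓ ι hcptK σ hLDS hℓ

/-- **Crux WITHOUT `Module.finrank F₀ K = 2`.**  The adelic group `U(J_N, cK)(𝔸)` depends only
on `(K, cK)`, not on `F₀`; the degree hypothesis serves to force `K^{cK} = F₀` (totally real).
Dropping it admits e.g. `[K : F₀] = 4`, `cK` of order `2` with `K^{cK}` a CM field, where the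
places of `K` over a complex place of `K^{cK}` are `cK`-swapped and unconstrained (non-algebraic
`σ` again: EXPECTED FALSE, open), and `cK` of order `> 2`, where `U(J_N, cK)` is an orthogonal-type
group over `K^{⟨cK⟩}` dressed in unitary vocabulary.  Not refutable in Lean. [folklore] -/
def WithoutDegreeTwo : Prop :=
  ∀ (F₀ K : Type) [Field F₀] [NumberField F₀] [Field K] [NumberField K] [Algebra F₀ K]
    (cK : K ≃ₐ[F₀] K), IsTotallyReal F₀ → ∀ (hc : cK ≠ 1),
    IsTotallyComplex K → ∀ (N : ℕ) (ℓ : ℕ) [Fact ℓ.Prime] (ι : PadicAlgCl ℓ ≃+* ℂ)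
    (hcptK : isCompact_glFiniteIntegralLevel N K)
    (σ : UnitaryGroup.CuspidalAutomorphicRepData F₀ K cK N hcptK),
    (∀ (w : {w : InfinitePlace K // w.IsComplex}) (hw : cK • w.1 = w.1),
      ∃ (p q : ℕ) (d : LDSDatum p q),
        UnitaryGroup.IsNondegenerateLimitOfDiscreteSeriesAt F₀ K cK N (StdForm.antidiagonal N)
          hcptK σ.1 hw hc d) →
    (∀ u : HeightOneSpectrum (𝓞 K), ((ℓ : ℕ) : 𝓞 K) ∈ u.asIdeal →
      u.asIdeal.ramificationIdx ℤ = 1 ∧ UnitaryGroup.IsUnramifiedAt F₀ K cK N hcptK σ.1 u) →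
    ∃ r : FramedGaloisRep K (PadicAlgCl ℓ) N, r.toGaloisRep.IsSemisimple ∧
      ∀ (u : HeightOneSpectrum (𝓞 K)) (β : Multiset ℂ), ((ℓ : ℕ) : 𝓞 K) ∉ u.asIdeal →
        (∀ u' : HeightOneSpectrum (𝓞 K), u'.asIdeal.under ℤ = u.asIdeal.under ℤ →
          u'.asIdeal.ramificationIdx ℤ = 1 ∧ UnitaryGroup.IsUnramifiedAt F₀ K cK N hcptK σ.1 u') →
        UnitaryGroup.HasBaseChangeSatakeAt F₀ K cK N hcptK σ.1 u β →
          r.IsUnramifiedAt u ∧ r.HasFrobCharpolyAt u (arithFrobPolyOfSatake ι u.residueCard N β)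

/-- Monotonicity. [folklore] -/
theorem crux_of_withoutDegreeTwo (h : WithoutDegreeTwo) : GaloisRepOfUnitaryLDS :=
  fun F₀ K _ _ _ _ _ cK hF₀ _ hc hKc N ℓ _ ι hcptK σ hLDS hℓ ↦
    h F₀ K cK hF₀ hc hKc N ℓ ι hcptK σ hLDS hℓ

/-! ## §4 Scope: the `ℓ = 2` stratum is inside the crux -/

/-- The crux at a FIXED prime `ℓ`. [folklore] -/
def AtPrime (ℓ : ℕ) [Fact ℓ.Prime] : Prop :=
  ∀ (F₀ K : Type) [Field F₀] [NumberField F₀] [Field K] [NumberField K] [Algebra F₀ K]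
    (cK : K ≃ₐ[F₀] K), IsTotallyReal F₀ → Module.finrank F₀ K = 2 → ∀ (hc : cK ≠ 1),
    IsTotallyComplex K → ∀ (N : ℕ) (ι : PadicAlgCl ℓ ≃+* ℂ)
    (hcptK : isCompact_glFiniteIntegralLevel N K)
    (σ : UnitaryGroup.CuspidalAutomorphicRepData F₀ K cK N hcptK),
    (∀ (w : {w : InfinitePlace K // w.IsComplex}) (hw : cK • w.1 = w.1),
      ∃ (p q : ℕ) (d : LDSDatum p q),
        UnitaryGroup.IsNondegenerateLimitOfDiscreteSeriesAt F₀ K cK N (StdForm.antidiagonal N)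
          hcptK σ.1 hw hc d) →
    (∀ u : HeightOneSpectrum (𝓞 K), ((ℓ : ℕ) : 𝓞 K) ∈ u.asIdeal →
      u.asIdeal.ramificationIdx ℤ = 1 ∧ UnitaryGroup.IsUnramifiedAt F₀ K cK N hcptK σ.1 u) →
    ∃ r : FramedGaloisRep K (PadicAlgCl ℓ) N, r.toGaloisRep.IsSemisimple ∧
      ∀ (u : HeightOneSpectrum (𝓞 K)) (β : Multiset ℂ), ((ℓ : ℕ) : 𝓞 K) ∉ u.asIdeal →
        (∀ u' : HeightOneSpectrum (𝓞 K), u'.asIdeal.under ℤ = u.asIdeal.under ℤ →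
          u'.asIdeal.ramificationIdx ℤ = 1 ∧ UnitaryGroup.IsUnramifiedAt F₀ K cK N hcptK σ.1 u') →
        UnitaryGroup.HasBaseChangeSatakeAt F₀ K cK N hcptK σ.1 u β →
          r.IsUnramifiedAt u ∧ r.HasFrobCharpolyAt u (arithFrobPolyOfSatake ι u.residueCard N β)

/-- `crux ↔ ∀ ℓ, AtPrime ℓ`. [folklore] -/
theorem crux_iff_forall_atPrime : GaloisRepOfUnitaryLDS ↔ ∀ (ℓ : ℕ) [Fact ℓ.Prime], AtPrime ℓ :=
  ⟨fun h ℓ _ F₀ K _ _ _ _ _ cK hF₀ hK hc hKc N ι hcptK σ ↦ h F₀ K cK hF₀ hK hc hKc N ℓ ι hcptK σ,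
    fun h F₀ K _ _ _ _ _ cK hF₀ hK hc hKc N ℓ _ ι hcptK σ ↦ h ℓ F₀ K cK hF₀ hK hc hKc N ι hcptK σ⟩

/-- **The crux splits as its `ℓ = 2` stratum plus its odd-`ℓ` strata.**  FAITHFULNESS FLAG (not a
falsity): `AtPrime 2` (whenever `2` is unramified in `K` and `σ` unramified above `2`) is admitted
by the crux but NOT covered by the cited proof — Goldring–Koskivirta carry the standing assumption
`p > 2` from §2.1.3 on (Kisin–Vasiu integral models); the printed substitute is Pilloni–Stroh 2016,
Cor. 3.13 (`N` even) / Rem. 3.12.1 (`N` odd, a remark).  The literature review of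
`UnitaryCoherentGaloisRep` records the same caveat; a planner wanting the verbatim-printed crux
restates it as the right conjunct. [cite: GoldringKoskivirta2019, §2.1.3 and Thm. 3.5.5] -/
theorem crux_iff_two_and_odd :
    GaloisRepOfUnitaryLDS ↔ AtPrime 2 ∧ ∀ (ℓ : ℕ) [Fact ℓ.Prime], 2 < ℓ → AtPrime ℓ := by
  rw [crux_iff_forall_atPrime]
  refine ⟨fun h ↦ ⟨h 2, fun ℓ _ _ ↦ h ℓ⟩, fun ⟨h2, hodd⟩ ℓ _ ↦ ?_⟩
  rcases (Fact.out : ℓ.Prime).eq_two_or_odd' with rfl | hℓ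
  · exact h2
  · exact hodd ℓ ((Fact.out : ℓ.Prime).two_le.lt_of_ne fun h ↦ by
      subst h; exact (Nat.not_even_iff_odd.mpr hℓ) even_two)

/-! ## §5 Line `Sketch` (card `hecke-algebra-valued-limit`): targets

The line's five stubs are quantified over the same honest interface, so none is refutable in Lean
for the reason of §2; what CAN be certified is recorded here.  (The stub statements are restated,
not imported: `Cruxes/…/Lines/Sketch.lean` carries `sorry`s.) -/

/-- **K2 `stub_regularDSGalois` is the crux restricted to REGULAR data** (`d.IsRegular` added to the
archimedean hypothesis), verbatim the statement registered in `Lines/Sketch.lean`. [folklore] -/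
def RegularCase : Prop :=
  ∀ (F₀ K : Type) [Field F₀] [NumberField F₀] [Field K] [NumberField K] [Algebra F₀ K]
    (cK : K ≃ₐ[F₀] K), IsTotallyReal F₀ → Module.finrank F₀ K = 2 → ∀ (hc : cK ≠ 1),
    IsTotallyComplex K → ∀ (N : ℕ) (ℓ : ℕ) [Fact ℓ.Prime] (ι : PadicAlgCl ℓ ≃+* ℂ)
    (hcptK : isCompact_glFiniteIntegralLevel N K)
    (σ' : UnitaryGroup.CuspidalAutomorphicRepData F₀ K cK N hcptK),
    (∀ (w : {w : InfinitePlace K // w.IsComplex}) (hw : cK • w.1 = w.1),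
      ∃ (p q : ℕ) (d : LDSDatum p q), d.IsRegular ∧
        UnitaryGroup.IsNondegenerateLimitOfDiscreteSeriesAt F₀ K cK N (StdForm.antidiagonal N)
          hcptK σ'.1 hw hc d) →
    (∀ u : HeightOneSpectrum (𝓞 K), ((ℓ : ℕ) : 𝓞 K) ∈ u.asIdeal →
      u.asIdeal.ramificationIdx ℤ = 1 ∧ UnitaryGroup.IsUnramifiedAt F₀ K cK N hcptK σ'.1 u) →
    ∃ r : FramedGaloisRep K (PadicAlgCl ℓ) N, r.toGaloisRep.IsSemisimple ∧
      ∀ (u : HeightOneSpectrum (𝓞 K)) (β : Multiset ℂ), ((ℓ : ℕ) : 𝓞 K) ∉ u.asIdeal →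
        (∀ u' : HeightOneSpectrum (𝓞 K), u'.asIdeal.under ℤ = u.asIdeal.under ℤ →
          u'.asIdeal.ramificationIdx ℤ = 1 ∧
            UnitaryGroup.IsUnramifiedAt F₀ K cK N hcptK σ'.1 u') →
        UnitaryGroup.HasBaseChangeSatakeAt F₀ K cK N hcptK σ'.1 u β →
          r.IsUnramifiedAt u ∧
            r.HasFrobCharpolyAt u (arithFrobPolyOfSatake ι u.residueCard N β)

/-- **The crux implies K2** (forget `d.IsRegular`): K2 is unrefutable unless the crux is, and a
refutation of K2 would refute the crux — the line risks nothing on K2's truth, only on its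
provability ([HLTT] Cor. 1.3 + `U → GU`). [folklore] -/
theorem regularCase_of_crux (h : GaloisRepOfUnitaryLDS) : RegularCase :=
  fun F₀ K _ _ _ _ _ cK hF₀ hK hc hKc N ℓ _ ι hcptK σ' hDS hℓ ↦
    h F₀ K cK hF₀ hK hc hKc N ℓ ι hcptK σ' (fun w hw ↦ by
      obtain ⟨p, q, d, -, hd⟩ := hDS w hw
      exact ⟨p, q, d, hd⟩) hℓ

/-- Characteristic polynomials are invariant under change of frame (Mathlib
`Matrix.charpoly_units_conj`; cf. the tree's `FramedRep.charpoly_conj`). [folklore] -/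
theorem charpoly_conj {G C : Type*} [Group G] [TopologicalSpace G] [CommRing C]
    [TopologicalSpace C] [IsTopologicalRing C] {n : ℕ} (P : GL (Fin n) C) (ρ : FramedRep G C n)
    (g : G) : FramedRep.charpoly (FramedRep.conj P ρ) g = FramedRep.charpoly ρ g := by
  simp only [FramedRep.charpoly, FramedRep.conj_apply, Units.val_mul, Matrix.coe_units_inv]
  exact Matrix.charpoly_units_conj P _

/-- **P2 is a corollary of the crux**: `GaloisRepOfUnitaryLDS → GoldringKoskivirta2019_heckeFieldFinite`
(the named fact into which the gate relocated `stub_heckeFieldFinite`).  The crux's `r` has a model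
`rE` over a finite `E/ℚ_ℓ` (`exists_hasQlModel_holds`, Baire — PROVED in the tree), characteristic
polynomials are invariant under the change of frame and commute with the inclusion `E ⊆ ℚ̄_ℓ`
(`FramedRep.charpoly_baseChange`), so every predicted Frobenius polynomial has coefficients in `E`.
Hence P2 carries no falsity risk beyond the crux's (its role in the line is as an INPUT of the
proof, where it is genuinely needed before `r` exists). [folklore] -/
theorem heckeFieldFinite_of_crux (h : GaloisRepOfUnitaryLDS) :
    GoldringKoskivirta2019_heckeFieldFinite := by
  intro F₀ K _ _ _ _ _ cK hF₀ hK hc hKc N ℓ _ ι hcptK σ hLDS hℓ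
  obtain ⟨r, -, hr⟩ := h F₀ K cK hF₀ hK hc hKc N ℓ ι hcptK σ hLDS hℓ
  obtain ⟨E, rE, hfd, P, hP⟩ := exists_hasQlModel_holds r
  refine ⟨E, hfd, fun u β hu hu' hβ k ↦ ?_⟩
  obtain ⟨𝔓, h𝔓⟩ := HeightOneSpectrum.primesAbove_nonempty u
  obtain ⟨φ, hφ⟩ := HeightOneSpectrum.exists_isArithFrobAt_of_mem_primesAbove_holds h𝔓
  have hchar : FramedRep.charpoly r φ = arithFrobPolyOfSatake ι u.residueCard N β :=
    (hr u β hu hu' hβ).2 𝔓 h𝔓 φ hφ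
  rw [← hchar, ← hP, charpoly_conj, FramedRep.charpoly_baseChange, Polynomial.coeff_map]
  exact SetLike.coe_mem _

/-- **The factorisation inequality of K1/K3 is not vacuous, I**: in the shape
"`∀ F`, (all `‖e_i F‖ ≤ δ`, `i < r`) `→ ‖e F‖ ≤ ℓ^{-m}`" with `e 1` of norm `1` (as for
`MvPolynomial.aeval`, a ring homomorphism into the normed field `ℚ̄_ℓ`), any witness at precision
`m ≥ 1` has a NON-EMPTY family `r ≥ 1` (test the constant polynomial `F = 1`).  So in
`stub_regularShadows` the regular shadows `σ'_j` must actually exist, and in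
`stub_algebraValuedLimit` the approximating family is non-empty for `m ≥ 1`. [folklore] -/
theorem family_pos_of_factorisation {V R : Type*} [NormedRing R] [NormOneClass R] {ℓ m r : ℕ}
    (hℓ : 1 < ℓ) (hm : 0 < m) (good : V → Prop) (e : MvPolynomial V ℤ → R) (he : e 1 = 1)
    (eQ : Fin r → MvPolynomial V ℤ → ℝ) (δ : ℝ)
    (h : ∀ F : MvPolynomial V ℤ, (∀ v ∈ F.vars, good v) → (∀ i : Fin r, eQ i F ≤ δ) →
      ‖e F‖ ≤ (ℓ : ℝ) ^ (-(m : ℤ))) : 0 < r := by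
  by_contra hr
  obtain rfl : r = 0 := Nat.eq_zero_of_not_pos hr
  have h1 := h 1 (by simp [MvPolynomial.vars_one]) (fun i ↦ i.elim0)
  rw [he, norm_one] at h1
  have hlt : (ℓ : ℝ) ^ (-(m : ℤ)) < 1 :=
    zpow_lt_one_of_neg₀ (by exact_mod_cast hℓ) (by omega)
  exact (h1.trans_lt hlt).false

/-- **The factorisation inequality of K1/K3 is not vacuous, II**: in the same shape, with every
`e_i 1` of norm `1`, any witness at precision `m ≥ 1` has `δ < 1` (again `F = 1`); iterating with
`F = ℓ^{m-1}` gives `δ < ℓ^{-(m-1)}` (not formalised).  So `δ` must shrink with `m`, as the card's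
`δ = ℓ^{-(m+e)}` does. [folklore] -/
theorem delta_lt_one_of_factorisation {V R : Type*} [NormedRing R] [NormOneClass R] {ℓ m r : ℕ}
    (hℓ : 1 < ℓ) (hm : 0 < m) (good : V → Prop) (e : MvPolynomial V ℤ → R) (he : e 1 = 1)
    (eQ : Fin r → MvPolynomial V ℤ → ℝ) (heQ : ∀ i, eQ i 1 = 1) (δ : ℝ)
    (h : ∀ F : MvPolynomial V ℤ, (∀ v ∈ F.vars, good v) → (∀ i : Fin r, eQ i F ≤ δ) →
      ‖e F‖ ≤ (ℓ : ℝ) ^ (-(m : ℤ))) : δ < 1 := by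
  by_contra hδ
  rw [not_lt] at hδ
  have h1 := h 1 (by simp [MvPolynomial.vars_one]) (fun i ↦ (heQ i).le.trans hδ)
  rw [he, norm_one] at h1
  have hlt : (ℓ : ℝ) ^ (-(m : ℤ)) < 1 :=
    zpow_lt_one_of_neg₀ (by exact_mod_cast hℓ) (by omega)
  exact (h1.trans_lt hlt).false

/-- **Limits are exact**: a quantity bounded by `ℓ^{-m}` for every `m` vanishes.  With the previous
two lemmas this is how K3's hypothesis (for ALL `m`) pins the prescribed polynomials: testing
`F = X_{(v,n)} - 1` and `F = X_{(v,k)}` (`k > n`), which every genuine Frobenius family kills,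
forces `P_v` monic of degree exactly `n` — K3 needs no extra shape hypothesis on `P` (paper check of
the lead's statement; the instantiation is left to the line). [folklore] -/
theorem eq_zero_of_forall_norm_le_zpow {R : Type*} [NormedAddCommGroup R] {ℓ : ℕ} (hℓ : 1 < ℓ)
    {x : R} (h : ∀ m : ℕ, ‖x‖ ≤ (ℓ : ℝ) ^ (-(m : ℤ))) : x = 0 := by
  by_contra hx
  have hpos : 0 < ‖x‖ := norm_pos_iff.mpr hx
  have hℓ' : (1 : ℝ) < ℓ := by exact_mod_cast hℓ
  obtain ⟨m, hm⟩ := pow_unbounded_of_one_lt ‖x‖⁻¹ hℓ'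
  have h1 := h m
  rw [zpow_neg, zpow_natCast] at h1
  have : (ℓ : ℝ) ^ m ≤ ‖x‖⁻¹ := by
    rw [le_inv_comm₀ (by positivity) hpos]; exact h1
  exact absurd hm (not_lt.mpr this)

end Summit.Langlands.Langlands.Cruxes.GaloisRepOfUnitaryLDS.Disproof

end
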